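import Summits.AtomisticToContinuum.HydrodynamicLimit.Theorems.DenseExcursion.Negative.AtTimeZero
import Summits.AtomisticToContinuum.HydrodynamicLimit.Theorems.VitaliAmplitudeTransferAmplitudeTransferProbability

/-!
# Amplitude transfer — identification of the macroscopic data from the law of large numbers

If, under the same sequence of probability laws and flows, the empirical density, momentum and
energy fields at a time `t` converge in probability both to the fields of `(ρ, u, θ)(t)` and to
those of `(ρ', u', θ')(t)` (`TendstoHydroFieldsAt`), and all six time slices are continuous with
`ρ t > 0`, then `(ρ, u, θ)(t) = (ρ', u', θ')(t)` pointwise: limits in probability are unique, so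
the tested fields agree for every continuous test function, and continuous functions on `𝕋³`
with equal integrals against all continuous test functions coincide
(`DenseExcursionAtTimeZero.eq_of_forall_integral_mul_eq`, reused from the tree).
-/

open MeasureTheory Filter Topology
open Literature.MathematicalPhysics.KineticTheory Literature.Analysis.FluidPDE

namespace Summit.AtomisticToContinuum.HydrodynamicLimit.Theorems.AmplitudeTransfer

/-- A coordinate of the Bochner integral of an integrable `ℝ³`-valued function is the integral of
the coordinate. -/
theorem integral_apply_V3 {α : Type*} [MeasurableSpace α] {μ : Measure α} {F : α → V3}
    (hF : Integrable F μ) (l : Fin 3) : (∫ x, F x ∂μ) l = ∫ x, F x l ∂μ := by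
  have h := ContinuousLinearMap.integral_comp_comm (EuclideanSpace.proj (𝕜 := ℝ) l) hF
  simpa using h.symm

/-- **Identification of the data by the law of large numbers.** Two macroscopic triples towards
which the empirical fields converge in probability at time `t`, under the same probability laws
and flows, have the same continuous time-`t` slices (given `ρ t > 0`, which is needed to cancel
the density in the momentum and energy fields). -/
theorem slices_eq_of_tendstoHydroFieldsAt {ε : ℕ → ℝ}
    {P : (N : ℕ) → Measure (Config (N + 1) (Fin 3) T3)} [∀ N, IsProbabilityMeasure (P N)]
    {Φ : (N : ℕ) → HardSphereFlow (Torus.geometry (Fin 3)) (ε N) (N + 1)}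
    {ρ θ ρ' θ' : ℝ → T3 → ℝ} {u u' : ℝ → T3 → V3} {t : ℝ}
    (h : TendstoHydroFieldsAt P Φ ρ u θ t) (h' : TendstoHydroFieldsAt P Φ ρ' u' θ' t)
    (hρ : Continuous (ρ t)) (hu : Continuous (u t)) (hθ : Continuous (θ t))
    (hρ' : Continuous (ρ' t)) (hu' : Continuous (u' t)) (hθ' : Continuous (θ' t))
    (hpos : ∀ x, 0 < ρ t x) :
    ρ t = ρ' t ∧ u t = u' t ∧ θ t = θ' t := by
  -- tested fields agree for every continuous test function
  have hd : ∀ χ : T3 → ℝ, Continuous χ → ∫ x, χ x * ρ t x = ∫ x, χ x * ρ' t x := fun χ hχ =>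
    eq_of_tendsto_measure_lt_abs_sub (X := fun N z => empiricalDensityField ((Φ N).flow t z) χ)
      (fun δ hδ => (h χ hχ δ hδ).1) (fun δ hδ => (h' χ hχ δ hδ).1)
  have hm : ∀ χ : T3 → ℝ, Continuous χ →
      ∫ x, (χ x * ρ t x) • u t x = ∫ x, (χ x * ρ' t x) • u' t x := fun χ hχ =>
    eq_of_tendsto_measure_lt_norm_sub (X := fun N z => empiricalMomentumField ((Φ N).flow t z) χ)
      (fun δ hδ => (h χ hχ δ hδ).2.1) (fun δ hδ => (h' χ hχ δ hδ).2.1)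
  have he : ∀ χ : T3 → ℝ, Continuous χ →
      ∫ x, χ x * totalEnergyDensity (ρ t x) (u t x) (θ t x) =
        ∫ x, χ x * totalEnergyDensity (ρ' t x) (u' t x) (θ' t x) := fun χ hχ =>
    eq_of_tendsto_measure_lt_abs_sub (X := fun N z => empiricalEnergyField ((Φ N).flow t z) χ)
      (fun δ hδ => (h χ hχ δ hδ).2.2) (fun δ hδ => (h' χ hχ δ hδ).2.2)
  -- density
  have hρeq : ρ t = ρ' t := DenseExcursionAtTimeZero.eq_of_forall_integral_mul_eq hρ hρ' hd
  -- momentum, coordinatewise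
  have hueq : u t = u' t := by
    have hcu : ∀ {w : T3 → V3}, Continuous w → ∀ l : Fin 3, Continuous fun x => w x l :=
      fun hw l => by
        have h := (EuclideanSpace.proj (𝕜 := ℝ) l).continuous.comp hw
        simp only [Function.comp_def] at h
        simpa using h
    have hcoord : ∀ l : Fin 3, (fun x => ρ t x * u t x l) = fun x => ρ t x * u' t x l := by
      intro l
      refine DenseExcursionAtTimeZero.eq_of_forall_integral_mul_eq (hρ.mul (hcu hu l))
        (hρ.mul (hcu hu' l)) fun χ hχ => ?_
      have h1 := hm χ hχ
      rw [← hρeq] at h1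
      have hi : Integrable fun x => (χ x * ρ t x) • u t x :=
        integrable_of_continuous_T3 ((hχ.mul hρ).smul hu)
      have hi' : Integrable fun x => (χ x * ρ t x) • u' t x :=
        integrable_of_continuous_T3 ((hχ.mul hρ).smul hu')
      have h2 := congr_arg (fun w : V3 => w l) h1
      simp only at h2
      rw [integral_apply_V3 hi l, integral_apply_V3 hi' l] at h2
      simp only [PiLp.smul_apply, smul_eq_mul] at h2
      simpa only [mul_assoc] using h2
    funext x
    have hρx : ρ t x ≠ 0 := (hpos x).ne'
    ext l
    have := congr_fun (hcoord l) x
    simp only at this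
    exact mul_left_cancel₀ hρx this
  -- temperature
  have hθeq : θ t = θ' t := by
    have hE : (fun x => totalEnergyDensity (ρ t x) (u t x) (θ t x)) =
        fun x => totalEnergyDensity (ρ t x) (u t x) (θ' t x) := by
      have hcont : ∀ {θ₁ : T3 → ℝ}, Continuous θ₁ →
          Continuous fun x => totalEnergyDensity (ρ t x) (u t x) (θ₁ x) := fun hθ₁ => by
        unfold totalEnergyDensity
        exact hρ.mul (((hu.norm.pow 2).div_const 2).add (continuous_const.mul hθ₁))
      refine DenseExcursionAtTimeZero.eq_of_forall_integral_mul_eq (hcont hθ) (hcont hθ') fun χ hχ => ?_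
      have h1 := he χ hχ
      rw [← hρeq, ← hueq] at h1
      exact h1
    funext x
    have hx := congr_fun hE x
    simp only [totalEnergyDensity] at hx
    have hρx : ρ t x ≠ 0 := (hpos x).ne'
    have := mul_left_cancel₀ hρx hx
    linarith
  exact ⟨hρeq, hueq, hθeq⟩

end Summit.AtomisticToContinuum.HydrodynamicLimit.Theorems.AmplitudeTransfer
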